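import Summits.Ventures.Crystal3D.Theorems.StickyWulffConstantPolycrystalWulffBoundDominantCharged

/-!
# `PolycrystalWulffBound`, line `PolyDensity`: CHARGED WALLS dominate `c₁ ×` the unit-ball interface of a
# lattice class with its complement (crux `stmt-Ventures-19482`; lane poly-p2, gen 24)

Route `StickyWulffConstant` of the venture `Summits/Ventures/Crystal3D`, second prover lane.  The wall
accounting of `…DominantCharged` (poly-p2 g23) as a standalone row: for a twin-free polyhedral crux texture
whose generic (non-co-axial) walls are charged `≥ c₁ ≥ 0` and any grain `f₀` (lattice class
`D = {f | A f Λ = A f₀ Λ}`, complement `Dᶜ`), the wall energy of the crux dominates `c₁` times the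
unit-ball interface of `D` with `Dᶜ`:

  `c₁ · Σ_{f ∈ D} Σ_{g ∈ Dᶜ} ι_{B̄(0,1)}(G f, G g) ≤ Σ_f Σ_g [f ≠ g] (c f g / 2)·ι_{Dsc(m f g)}(G f, G g)`

(pairs in different classes are non-co-axial by twin-freeness, so `m = 0`, `Dsc 0 = B̄(0,1)` and
`c f g ≥ c₁`; same-class walls are `≥ 0`; the two orientations of each cross pair give the factor `2`).
Charge-`1` predecessor: `walls_ge_crossClass` (`…WallRow`, g4).  Consumed by `…TwoClassBallCut`.
WHAT THIS IS NOT: a rung; twins; the crux is not claimed.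
-/

noncomputable section

open scoped BigOperators InnerProductSpace ENNReal
open MeasureTheory Filter

namespace Summit.Ventures.Crystal3D.Cruxes.PolycrystalWulffBound.PolyDensity

open Summit.Ventures.Crystal3D.Theorems
open Summit.Ventures.Crystal3D.Cruxes.TextureLiminf.TexShadow (per polytope E3)
open Literature.MathematicalPhysics.StatisticalMechanics (perimeter)

/-- **Charged walls dominate `c₁ ×` the class/complement unit-ball interface.**  See the module
docstring. -/
theorem walls_ge_chargedInterface :
    let Λ : Set (EuclideanSpace ℝ (Fin 3)) := Literature.MathematicalPhysics.StatisticalMechanics.fccStacking 1 (Real.sqrt (2 / 3));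
    let Brl : (ℤ → ℤ) → Set (EuclideanSpace ℝ (Fin 3)) := Literature.MathematicalPhysics.StatisticalMechanics.barlowStacking 1 (Real.sqrt (2 / 3));
    let Ax : EuclideanSpace ℝ (Fin 3) → (EuclideanSpace ℝ (Fin 3) ≃ₗᵢ[ℝ] EuclideanSpace ℝ (Fin 3)) → (EuclideanSpace ℝ (Fin 3) ≃ₗᵢ[ℝ] EuclideanSpace ℝ (Fin 3)) → Prop := fun m A B => ∃ (L : EuclideanSpace ℝ (Fin 3) ≃ₗᵢ[ℝ] EuclideanSpace ℝ (Fin 3)) (s₁ s₂ : EuclideanSpace ℝ (Fin 3)) (σ σ' : ℤ → ℤ), Literature.MathematicalPhysics.StatisticalMechanics.IsHaggSeq σ ∧ Literature.MathematicalPhysics.StatisticalMechanics.IsHaggSeq σ' ∧ L (EuclideanSpace.single (2 : Fin 3) (1 : ℝ)) = m ∧ A '' Λ ⊆ (fun q => L q + s₁) '' Brl σ ∧ B '' Λ ⊆ (fun q => L q + s₂) '' Brl σ';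
    let CoAx : (EuclideanSpace ℝ (Fin 3) ≃ₗᵢ[ℝ] EuclideanSpace ℝ (Fin 3)) → (EuclideanSpace ℝ (Fin 3) ≃ₗᵢ[ℝ] EuclideanSpace ℝ (Fin 3)) → Prop := fun A B => ∃ m, Ax m A B;
    let Per : Set (EuclideanSpace ℝ (Fin 3)) → Set (EuclideanSpace ℝ (Fin 3)) → ℝ := fun K S => (⨆ (ξ : EuclideanSpace ℝ (Fin 3) → EuclideanSpace ℝ (Fin 3)) (_ : ContDiff ℝ 1 ξ ∧ HasCompactSupport ξ ∧ ∀ z, ξ z ∈ K), ENNReal.ofReal (∫ z in S, Literature.MathematicalPhysics.StatisticalMechanics.fieldDivergence ξ z)).toReal;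
    let ι : Set (EuclideanSpace ℝ (Fin 3)) → Set (EuclideanSpace ℝ (Fin 3)) → Set (EuclideanSpace ℝ (Fin 3)) → ℝ := fun K S₁ S₂ => (Per K S₁ + Per K S₂ - Per K (S₁ ∪ S₂)) / 2;
    let Dsc : EuclideanSpace ℝ (Fin 3) → Set (EuclideanSpace ℝ (Fin 3)) := fun m => {y | ‖y‖ ≤ 1 ∧ ⟪y, m⟫_ℝ = 0};
    let Tex : (n : ℕ) → (Fin n → Set (EuclideanSpace ℝ (Fin 3))) → (Fin n → (EuclideanSpace ℝ (Fin 3) ≃ₗᵢ[ℝ] EuclideanSpace ℝ (Fin 3))) → (Fin n → Fin n → ℝ) → (Fin n → Fin n → EuclideanSpace ℝ (Fin 3)) → Prop := fun n G A c m => (∀ f : Fin n, Literature.MathematicalPhysics.StatisticalMechanics.HasFinitePerimeter (G f) ∧ volume (G f) < ⊤) ∧ (∀ f g, f ≠ g → Disjoint (G f) (G g)) ∧ (∀ f g, f ≠ g → 0 ≤ c f g) ∧ (∀ f g, f ≠ g → ¬ CoAx (A f) (A g) → m f g = 0 ∧ 1 ≤ c f g) ∧ (∀ f g, f ≠ g →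 CoAx (A f) (A g) → A f '' Λ ≠ A g '' Λ → Ax (m f g) (A f) (A g) ∧ 1 / 2 ≤ c f g);
    let Poly : Set (EuclideanSpace ℝ (Fin 3)) → Prop := fun S => ∃ (k : ℕ) (H : Fin k → Finset ((EuclideanSpace ℝ (Fin 3)) × ℝ)), S = ⋃ i, ⋂ p ∈ H i, {x | ⟪p.1, x⟫_ℝ < p.2};
    let TF : (n : ℕ) → (Fin n → (EuclideanSpace ℝ (Fin 3) ≃ₗᵢ[ℝ] EuclideanSpace ℝ (Fin 3))) → Prop := fun n A => ∀ f g : Fin n, f ≠ g → CoAx (A f) (A g) → A f '' Λ = A g '' Λ;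
    ∀ (c₁ : ℝ) (n : ℕ) (G : Fin n → Set (EuclideanSpace ℝ (Fin 3))) (A : Fin n → (EuclideanSpace ℝ (Fin 3) ≃ₗᵢ[ℝ] EuclideanSpace ℝ (Fin 3))) (c : Fin n → Fin n → ℝ) (m : Fin n → Fin n → EuclideanSpace ℝ (Fin 3)) (f₀ : Fin n), Tex n G A c m → (∀ f, Poly (G f)) → TF n A → 0 ≤ c₁ → (∀ f g : Fin n, f ≠ g → ¬ CoAx (A f) (A g) → c₁ ≤ c f g) →
      c₁ * (∑ f ∈ Finset.univ.filter (fun f => A f '' Λ = A f₀ '' Λ),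
          ∑ g ∈ Finset.univ \ Finset.univ.filter (fun f => A f '' Λ = A f₀ '' Λ),
            (if f = g then 0 else ι (Metric.closedBall (0 : EuclideanSpace ℝ (Fin 3)) 1) (G f) (G g))) ≤
        ∑ f, ∑ g, (if f = g then 0 else c f g / 2 * ι (Dsc (m f g)) (G f) (G g)) := by
  intro Λ Brl Ax CoAx Per ι Dsc Tex Poly TF c₁ n G A c m f₀ hTex hPoly hTF hc₁ hCh
  classical
  obtain ⟨hfin, hdisj, hc0, hgen, -⟩ := hTex
  have hvol : ∀ f, volume (G f) < ⊤ := fun f => (hfin f).2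
  -- lattice classes; the dominant class `D` and the satellites `Dc`
  set lat : Fin n → Set E3 := fun f => A f '' Λ with hlat
  set D : Finset (Fin n) := Finset.univ.filter (fun f => lat f = lat f₀) with hD
  set Dc : Finset (Fin n) := Finset.univ \ D with hDc
  have hmemD : ∀ f, f ∈ D ↔ lat f = lat f₀ := fun f => by simp [hD]
  have hmemDc : ∀ f, f ∈ Dc ↔ lat f ≠ lat f₀ := fun f => by simp [hDc, hD]
  have hDcsub : D ⊆ Finset.univ := Finset.subset_univ D
  have hDc_eq : Dc = Finset.univ.filter (fun f => ¬ lat f = lat f₀) := by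
    ext f; simp [hDc, hD]
  -- pairs in different classes carry generic walls
  have hwall : ∀ f g, lat f ≠ lat g → m f g = 0 ∧ c₁ ≤ c f g := fun f g hne =>
    ⟨(hgen f g (fun h => hne (h ▸ rfl)) (fun hco => hne (hTF f g (fun h => hne (h ▸ rfl)) hco))).1,
      hCh f g (fun h => hne (h ▸ rfl)) (fun hco => hne (hTF f g (fun h => hne (h ▸ rfl)) hco))⟩
  -- bodies
  have hDsc0 : Dsc 0 = Metric.closedBall (0 : E3) 1 := by
    show {y : E3 | ‖y‖ ≤ 1 ∧ ⟪y, (0 : E3)⟫_ℝ = 0} = Metric.closedBall 0 1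
    ext y
    simp [inner_zero_right]
  have hBallc : ∀ r : ℝ, IsCompact (Metric.closedBall (0 : E3) r) := fun r => isCompact_closedBall 0 r
  have hBallv : ∀ r : ℝ, Convex ℝ (Metric.closedBall (0 : E3) r) := fun r => convex_closedBall 0 r
  have hBall0 : ∀ {r : ℝ}, 0 ≤ r → (0 : E3) ∈ Metric.closedBall (0 : E3) r := fun hr =>
    Metric.mem_closedBall_self hr
  have hBc := hBallc 1; have hBv := hBallv 1; have hB0 : (0 : E3) ∈ Metric.closedBall (0 : E3) 1 := hBall0 zero_le_one
  have hDscC : ∀ v : E3, IsCompact (Dsc v) := fun v =>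
    Metric.isCompact_of_isClosed_isBounded
      ((isClosed_le continuous_norm continuous_const).inter
        (isClosed_eq (continuous_id.inner continuous_const) continuous_const))
      (Metric.isBounded_closedBall.subset (cruxDisc_subset_closedBall v))
  -- the unit-ball interface terms `w`
  set w : Fin n → Fin n → ℝ := fun f g => if f = g then 0 else
    (per (Metric.closedBall (0 : E3) 1) (G f) + per (Metric.closedBall (0 : E3) 1) (G g) -
      per (Metric.closedBall (0 : E3) 1) (G f ∪ G g)) / 2 with hw
  have hw0 : ∀ f g, 0 ≤ w f g := by
    intro f g
    by_cases hfg : f = g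
    · simp only [hw, hfg, if_true]; exact le_rfl
    · simp only [hw, hfg, if_false]
      exact div_nonneg (iota_nonneg_of_poly G hPoly hvol hdisj hBc hBv hB0 hfg) zero_le_two
  have hwsymm : ∀ f g, w f g = w g f := fun f g => iota_kernel_symm _ G f g
  -- the dominant/satellite interface `A₁` and its mirror `A₂`
  set A₁ : ℝ := ∑ f ∈ D, ∑ g ∈ Dc, w f g with hA₁
  set A₂ : ℝ := ∑ f ∈ Dc, ∑ g ∈ D, w f g with hA₂
  have hA₁₂ : A₂ = A₁ := by
    rw [hA₂, hA₁, Finset.sum_comm]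
    exact Finset.sum_congr rfl fun f _ => Finset.sum_congr rfl fun g _ => hwsymm g f
  -- the wall energy dominates `c₁ ×` the different-class interface terms
  have hterm : ∀ f g, c₁ * (if lat g = lat f then 0 else w f g) ≤
      2 * (if f = g then 0 else c f g / 2 * ι (Dsc (m f g)) (G f) (G g)) := by
    intro f g
    by_cases hfg : f = g
    · rw [if_pos (by rw [hfg]), if_pos hfg, mul_zero, mul_zero]
    · rw [if_neg hfg]
      by_cases hl : lat g = lat f
      · rw [if_pos hl, mul_zero]
        have hnn := iota_nonneg_of_poly G hPoly hvol hdisj (hDscC (m f g)) (convex_cruxDisc (m f g))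
          (zero_mem_cruxDisc (m f g)) hfg
        have hc := hc0 f g hfg
        show (0 : ℝ) ≤ 2 * (c f g / 2 * ((per (Dsc (m f g)) (G f) + per (Dsc (m f g)) (G g) -
          per (Dsc (m f g)) (G f ∪ G g)) / 2))
        have : 0 ≤ c f g * (per (Dsc (m f g)) (G f) + per (Dsc (m f g)) (G g) -
          per (Dsc (m f g)) (G f ∪ G g)) := mul_nonneg hc hnn
        linarith
      · rw [if_neg hl]
        obtain ⟨hm, hc⟩ := hwall f g (fun h => hl h.symm)
        rw [hm, hDsc0]
        have hnn := iota_nonneg_of_poly G hPoly hvol hdisj hBc hBv hB0 hfg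
        simp only [hw, hfg, if_false]
        show c₁ * ((per (Metric.closedBall (0 : E3) 1) (G f) +
            per (Metric.closedBall (0 : E3) 1) (G g) - per (Metric.closedBall (0 : E3) 1) (G f ∪ G g)) / 2) ≤
          2 * (c f g / 2 * ((per (Metric.closedBall (0 : E3) 1) (G f) +
            per (Metric.closedBall (0 : E3) 1) (G g) - per (Metric.closedBall (0 : E3) 1) (G f ∪ G g)) / 2))
        have hprod : 0 ≤ (c f g - c₁) * (per (Metric.closedBall (0 : E3) 1) (G f) +
            per (Metric.closedBall (0 : E3) 1) (G g) - per (Metric.closedBall (0 : E3) 1) (G f ∪ G g)) :=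
          mul_nonneg (sub_nonneg.2 hc) hnn
        nlinarith
  have hWl : c₁ * (∑ f, ∑ g, (if lat g = lat f then 0 else w f g)) ≤
      2 * ∑ f, ∑ g, (if f = g then 0 else c f g / 2 * ι (Dsc (m f g)) (G f) (G g)) := by
    have hsum : (∑ f, ∑ g, c₁ * (if lat g = lat f then 0 else w f g)) ≤
        ∑ f, ∑ g, 2 * (if f = g then 0 else c f g / 2 * ι (Dsc (m f g)) (G f) (G g)) :=
      Finset.sum_le_sum fun f _ => Finset.sum_le_sum fun g _ => hterm f g
    simp_rw [← Finset.mul_sum] at hsum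
    exact hsum
  -- `A₁ + A₂ ≤ Σ_f Σ_g [different classes] w f g`
  have hsplit : ∀ F : Fin n → ℝ, (∑ f, F f) = (∑ f ∈ D, F f) + ∑ f ∈ Dc, F f := by
    intro F
    rw [hDc, ← Finset.sum_sdiff hDcsub, add_comm]
  have hinnerD : ∀ f ∈ D, (∑ g, (if lat g = lat f then 0 else w f g)) = ∑ g ∈ Dc, w f g := by
    intro f hf
    rw [(hmemD f).1 hf, hDc_eq, Finset.sum_filter]
    refine Finset.sum_congr rfl fun g _ => ?_
    by_cases h : lat g = lat f₀
    · rw [if_pos h, if_neg (not_not.2 h)]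
    · rw [if_neg h, if_pos h]
  have hinnerDc : ∀ f ∈ Dc, (∑ g ∈ D, w f g) ≤ ∑ g, (if lat g = lat f then 0 else w f g) := by
    intro f hf
    have hlf : lat f ≠ lat f₀ := (hmemDc f).1 hf
    calc (∑ g ∈ D, w f g) = ∑ g ∈ D, (if lat g = lat f then 0 else w f g) := by
          refine Finset.sum_congr rfl fun g hg => ?_
          rw [if_neg (fun h => hlf (h.symm.trans ((hmemD g).1 hg)))]
      _ ≤ ∑ g, (if lat g = lat f then 0 else w f g) :=
          Finset.sum_le_sum_of_subset_of_nonneg (Finset.subset_univ D) fun g _ _ => by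
            split_ifs
            · exact le_rfl
            · exact hw0 f g
  have hAle : A₁ + A₂ ≤ ∑ f, ∑ g, (if lat g = lat f then 0 else w f g) := by
    have e := hsplit (fun f => ∑ g, (if lat g = lat f then 0 else w f g))
    have eD : (∑ f ∈ D, ∑ g, (if lat g = lat f then 0 else w f g)) = A₁ := Finset.sum_congr rfl hinnerD
    have eDc : A₂ ≤ ∑ f ∈ Dc, ∑ g, (if lat g = lat f then 0 else w f g) := Finset.sum_le_sum hinnerDc
    linarith
  have hWallA : c₁ * A₁ ≤ ∑ f, ∑ g, (if f = g then 0 else c f g / 2 * ι (Dsc (m f g)) (G f) (G g)) := by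
    have hmul := mul_le_mul_of_nonneg_left hAle hc₁
    rw [hA₁₂] at hmul
    nlinarith
  exact hWallA

end Summit.Ventures.Crystal3D.Cruxes.PolycrystalWulffBound.PolyDensity

end
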